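import Literature.Geometry.Lorentzian.AFLinearEnergy
import Literature.Geometry.Lorentzian.ConformalFactorSmooth
import Literature.Geometry.Lorentzian.ConformalFactorAsymptotics
import Literature.Geometry.Lorentzian.ConformalChange
import Literature.Geometry.Lorentzian.BlackHoles
import Literature.Geometry.Lorentzian.RicciVariationSteps
import HarnessLib

/-!
# `‖φ − 1‖_{L⁶}` for the scalar-flat conformal factor (Schoen–Yau 1979, Lemma 3.3 along `ds²_t`)

In the proof of Thm. 2 of Schoen–Yau (Comm. Math. Phys. 65 (1979), pp. 72–74) the metrics
`ds²_t = ds² + t Ric` are conformally deformed to scalar-flat, asymptotically Schwarzschildean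
metrics `φ_t⁴ ds²_t` by Lemma 3.3, `φ_t = 1 + v_t` with `v_t` the Lemma 3.2 solution of
`Δ_t v − (R_t/8) v = R_t/8`. This file extracts from the *recorded* output of that step (a positive
factor `φ` with `φ⁴ h₂` scalar flat and asymptotically Schwarzschildean, `h₂` asymptotically
Schwarzschildean of mass `0`) the equation and the `L⁶` estimate of `v = φ − 1`:

* `InitialDataSet.dalembertian_conformalFactor_eq` — `Δ_{h₂} φ = R(h₂) φ / 8` (the conformal law
  `R(φ⁴h) = φ⁻⁵(Rφ − 8Δφ)`, `conformal_scalarCurvature_law`, with `φ ∈ C^∞` by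
  `contMDiff_conformalFactor`);
* `InitialDataSet.dalembertian_conformalFactor_sub_one_eq` — `v = φ − 1` solves
  `Δ v − (R/8) v = R/8`;
* `AFEnd.integral_pow_six_conformalFactor_sub_one_le` — **`∫ |φ − 1|⁶ dV ≤ (c₁ ‖R/8‖_{6/5} / (1 − θ))⁶`**,
  `θ = c₁ ‖(R/8)₋‖_{3/2} < 1`, from the energy estimate
  `AFEnd.integral_pow_six_le_of_dalembertian_sub_mul_eq` (`AFLinearEnergy.lean`) and the decay
  `v ∘ Φ = O(1/r)` (`AFEnd.isBigO_endValue_sub_one`).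

This is the ingredient making the term `∫ (R_t/t)(φ_t − 1) dV_t` of the derivative of the mass
integral (3.27) vanish as `t → 0`. All results are proved; no definitions, no named facts.

## References

* R. Schoen, S.-T. Yau, Comm. Math. Phys. 65 (1979) 45–76, Lemma 3.2 (3.5) (p. 65), Lemma 3.3
  (pp. 71–72), (3.27)–(3.30) (p. 73).
-/

noncomputable section

open Set Function Filter Metric Bornology Asymptotics MeasureTheory Measure TopologicalSpace
  Manifold Bundle
open scoped Topology Manifold ContDiff ENNReal

namespace Literature.Geometry.Lorentzian

open Literature.Geometry.Riemannian PseudoRiemannianMetric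

namespace InitialDataSet

variable {X : Type} [TopologicalSpace X] [ChartedSpace E3 X] [IsManifold (𝓡 3) ∞ X]

/-- **`Δφ = Rφ/8` for a scalar-flat conformal factor**: if the metric of `D''` is `φ⁴ h₂`
pointwise with `φ > 0` and `R(D'') ≡ 0`, then `Δ_{h₂} φ = R(h₂) φ / 8` (the conformal law
`R(φ⁴ h) = φ⁻⁵ (R φ − 8 Δφ)`; `φ` is smooth by `contMDiff_conformalFactor`). This is (3.8) of
Schoen–Yau with `R(φ⁴ h) = 0`, the equation of Lemma 3.3. [cite: SchoenYauPMT1979, (3.8) and Lemma 3.3 (p. 71)] -/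
theorem dalembertian_conformalFactor_eq (D₂ D'' : InitialDataSet (𝓡 3) X) [D₂.metric.HasLeviCivita]
    {φ : X → ℝ} (hpos : ∀ x, 0 < φ x)
    (hconf : ∀ (x : X) (v w : TangentSpace (𝓡 3) x),
      D''.metric.val x v w = φ x ^ 4 * D₂.metric.val x v w)
    (hflat : ∀ x, D''.scalarCurvatureFn x = 0) (x : X) :
    D₂.metric.dalembertian φ x = D₂.scalarCurvatureFn x * φ x / 8 := by
  haveI := D''.metric.hasLeviCivita
  have hφs : ContMDiff (𝓡 3) 𝓘(ℝ, ℝ) ∞ φ :=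
    contMDiff_conformalFactor D₂.metric D''.metric D₂.isRiemannian_metric hpos hconf
  have hlaw := conformal_scalarCurvature_law X D₂.metric D''.metric φ D₂.isRiemannian_metric hφs
    hpos hconf x
  have h0 : D''.metric.scalarCurvature x = 0 := by rw [← scalarCurvatureFn_eq]; exact hflat x
  rw [h0] at hlaw
  have hφ5 : (φ x ^ 5)⁻¹ ≠ 0 := inv_ne_zero (pow_ne_zero 5 (hpos x).ne')
  have h1 : D₂.metric.scalarCurvature x * φ x - 8 * D₂.metric.dalembertian φ x = 0 := by
    rcases mul_eq_zero.1 hlaw.symm with h | h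
    · exact absurd h hφ5
    · exact h
  rw [scalarCurvatureFn_eq]
  linarith

/-- **`v = φ − 1` solves `Δv − (R/8) v = R/8`** under the hypotheses of
`dalembertian_conformalFactor_eq` (`Δ(φ − 1) = Δφ`, constants are harmonic). This is the
equation of Lemma 3.2 solved in Lemma 3.3 of Schoen–Yau. [cite: SchoenYauPMT1979, Lemma 3.3 (p. 71)] -/
theorem dalembertian_conformalFactor_sub_one_eq (D₂ D'' : InitialDataSet (𝓡 3) X)
    [D₂.metric.HasLeviCivita] {φ : X → ℝ} (hpos : ∀ x, 0 < φ x)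
    (hconf : ∀ (x : X) (v w : TangentSpace (𝓡 3) x),
      D''.metric.val x v w = φ x ^ 4 * D₂.metric.val x v w)
    (hflat : ∀ x, D''.scalarCurvatureFn x = 0) (x : X) :
    D₂.metric.dalembertian (fun y ↦ φ y - 1) x -
        D₂.scalarCurvatureFn x / 8 * (φ x - 1) = D₂.scalarCurvatureFn x / 8 := by
  have hφs : ContMDiff (𝓡 3) 𝓘(ℝ, ℝ) ∞ φ :=
    contMDiff_conformalFactor D₂.metric D''.metric D₂.isRiemannian_metric hpos hconf
  have hsub : D₂.metric.dalembertian (fun y ↦ φ y - 1) x =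
      D₂.metric.dalembertian φ x - D₂.metric.dalembertian (fun _ : X ↦ (1 : ℝ)) x := by
    have h := dalembertian_sub D₂.metric (f₁ := φ) (f₂ := fun _ : X ↦ (1 : ℝ)) (p := x)
      ((hφs x).of_le (WithTop.coe_le_coe.2 le_top)) contMDiffAt_const
    exact h
  rw [hsub, PseudoRiemannianMetric.dalembertian_const, sub_zero,
    D₂.dalembertian_conformalFactor_eq D'' hpos hconf hflat x]
  ring

end InitialDataSet

namespace AFEnd

variable {X : Type} [TopologicalSpace X] [ChartedSpace E3 X] [IsManifold (𝓡 3) ∞ X]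
  [T2Space X] [LocallyCompactSpace X] [SigmaCompactSpace X] [MeasurableSpace X] [BorelSpace X]
  (e : AFEnd X) (D₂ : InitialDataSet (𝓡 3) X)

/-- **`∫ |φ − 1|⁶ dV ≤ (c₁ ‖R/8‖_{6/5} / (1 − θ))⁶` for the scalar-flat conformal factor**
(Schoen–Yau 1979, Lemma 3.3 with the energy estimate of Lemma 3.2): let `h₂` (the metric of
`D₂`) be asymptotically flat on the only end `e`, asymptotically Schwarzschildean of mass `0`, and
satisfy the Sobolev inequality with constant `c₁`; let `φ > 0` with `φ⁴ h₂` (the metric of `D''`)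
scalar flat and asymptotically Schwarzschildean of some mass. If `(R/8)₋ ∈ L^{3/2}` with
`θ = c₁ ‖(R/8)₋‖_{3/2} < 1` and `R/8 ∈ L^{6/5}` (`R = R(h₂)`), then `|φ − 1|⁶` is integrable and
`∫ |φ − 1|⁶ dV_{h₂} ≤ (c₁ (∫ |R/8|^{6/5})^{5/6} / (1 − θ))⁶` — `v = φ − 1` solves
`Δv − (R/8)v = R/8` (`dalembertian_conformalFactor_sub_one_eq`), is `C²`
(`contMDiff_conformalFactor`) and `O(1/r)` (`isBigO_endValue_sub_one`), so
`integral_pow_six_le_of_dalembertian_sub_mul_eq` applies.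
[cite: SchoenYauPMT1979, Lemma 3.2 (3.5) (p. 65) and Lemma 3.3 (pp. 71–72)] -/
theorem integral_pow_six_conformalFactor_sub_one_le [D₂.metric.HasLeviCivita] {α : ℝ} (hα : 0 < α)
    (hAF : e.IsMetricAsymptoticallyFlat D₂ α) (hsole : e.IsSoleEnd) {c₁ : ℝ} (hc₁ : 0 ≤ c₁)
    (hS : ∀ ζ : X → ℝ, ContMDiff (𝓡 3) 𝓘(ℝ, ℝ) 1 ζ → HasCompactSupport ζ →
      (∫ x, |ζ x| ^ 6 ∂riemannianMeasure D₂.h) ^ (1 / 3 : ℝ) ≤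
        c₁ * ∫ x, D₂.metric.innerDual x (mvfderiv (𝓡 3) ζ x).toLinearMap
          (mvfderiv (𝓡 3) ζ x).toLinearMap ∂riemannianMeasure D₂.h)
    {D'' : InitialDataSet (𝓡 3) X} {φ : X → ℝ} {m : ℝ} {nh nh' : ℕ}
    (hAS₂ : IsAsymptoticallySchwarzschild e D₂ 0 nh) (hAS'' : IsAsymptoticallySchwarzschild e D'' m nh')
    (hpos : ∀ x, 0 < φ x)
    (hconf : ∀ (x : X) (v w : TangentSpace (𝓡 3) x),
      D''.metric.val x v w = φ x ^ 4 * D₂.metric.val x v w)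
    (hflat : ∀ x, D''.scalarCurvatureFn x = 0)
    (hfi : Integrable (fun x ↦ max (-(D₂.scalarCurvatureFn x / 8)) 0 ^ (3 / 2 : ℝ))
      (riemannianMeasure D₂.h))
    (hθ : c₁ * (∫ x, max (-(D₂.scalarCurvatureFn x / 8)) 0 ^ (3 / 2 : ℝ) ∂riemannianMeasure D₂.h) ^
      (2 / 3 : ℝ) < 1)
    (hgi : Integrable (fun x ↦ |D₂.scalarCurvatureFn x / 8| ^ (6 / 5 : ℝ)) (riemannianMeasure D₂.h)) :
    Integrable (fun x ↦ |φ x - 1| ^ 6) (riemannianMeasure D₂.h) ∧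
      ∫ x, |φ x - 1| ^ 6 ∂riemannianMeasure D₂.h ≤
        (c₁ * (∫ x, |D₂.scalarCurvatureFn x / 8| ^ (6 / 5 : ℝ) ∂riemannianMeasure D₂.h) ^ (5 / 6 : ℝ) /
          (1 - c₁ * (∫ x, max (-(D₂.scalarCurvatureFn x / 8)) 0 ^ (3 / 2 : ℝ)
            ∂riemannianMeasure D₂.h) ^ (2 / 3 : ℝ))) ^ 6 := by
  have hφs : ContMDiff (𝓡 3) 𝓘(ℝ, ℝ) ∞ φ :=
    contMDiff_conformalFactor D₂.metric D''.metric D₂.isRiemannian_metric hpos hconf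
  have hRc : Continuous fun x ↦ D₂.scalarCurvatureFn x / 8 := by
    have h := D₂.metric.contMDiff_scalarCurvature.continuous
    have h' : Continuous D₂.scalarCurvatureFn := by
      refine h.congr fun x ↦ ?_
      exact (D₂.scalarCurvatureFn_eq x).symm
    exact h'.div_const 8
  have hv : ContMDiff (𝓡 3) 𝓘(ℝ, ℝ) 2 fun x ↦ φ x - 1 :=
    (hφs.of_le (WithTop.coe_le_coe.2 le_top)).sub contMDiff_const
  have hpde : ∀ x, D₂.metric.dalembertian (fun y ↦ φ y - 1) x -
      D₂.scalarCurvatureFn x / 8 * (φ x - 1) = D₂.scalarCurvatureFn x / 8 :=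
    D₂.dalembertian_conformalFactor_sub_one_eq D'' hpos hconf hflat
  have hdec : endValue e (fun x ↦ φ x - 1) =O[cobounded E3] fun z ↦ ‖z‖⁻¹ := by
    have h := e.isBigO_endValue_sub_one hAS₂ hAS'' hpos hconf
    refine h.congr' ?_ EventuallyEq.rfl
    filter_upwards [eventually_cobounded_lt_norm (E := E3) e.R] with z hz
    simp only [endValue_of_lt e _ hz]
  exact e.integral_pow_six_le_of_dalembertian_sub_mul_eq D₂ hα hAF hsole hc₁ hS hRc hRc hfi hθ hgi
    hv hpde hdec

end AFEnd

end Literature.Geometry.Lorentzian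

end
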